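import Literature.Algebra.EuclideanLattices.GaussianLatticeMoments
import Literature.Algebra.EuclideanLattices.GaussianLatticeTails
import Literature.Probability.Moments.IIDSecondMoment
import HarnessLib

/-!
# Sampling Aharonov–Regev witnesses from the dual discrete Gaussian: good tuples exist

Topic `Algebra/EuclideanLattices` (family `pqc`; serves the decomposition of Aharonov–Regev 2005,
Thm. 1.1, coNP part = `gapCVP_sqrt_mem_promiseCoNP`). Everything PROVED; this is the
probabilistic half of the COMPLETENESS of the §6 verifier (§6.2), in a second-moment form valid for
a single target point, and it is design-agnostic: it serves both integer renderings of the verifier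
in the tree (`ARVerifier.lean` — trace test, distance-to-`ℤ` statistic — and
`GapCVPCoNPWitness.lean` — `FarCert`, counting test, PSD certificate), which differ only in how the
conclusions below are certified to a machine.

Setting: `L` a full lattice in a euclidean space `V` (`n = finrank ℝ V`), `s > 0`; the witness
vectors are i.i.d. samples from `D_{L*, 1/s}` (`dualGaussian L s`, the discrete Gaussian of
parameter `1/s` on the dual lattice — AR05's `f̂`, Cor. 4.2, for the primal Gaussian `ρ_s`).

## Results

* `dualGaussian_toReal`, `integral_dualGaussian_eq`, `measureReal_dualGaussian_eq` — weights,
  expectations and probabilities under `D_{L*,1/s}` as normalised Gaussian series, so that the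
  series bounds of `GaussianLatticeSums/Tails/Moments.lean` become probabilistic statements:
  `measureReal_dualGaussian_tail_le` (`Pr[‖w‖ ≥ c√n/s] ≤ (c√(2πe)e^{-πc²})ⁿ`, Banaszczyk 1.5 /
  AR Lemma 2.5), `le_integral_dualGaussian_distInt_sq` (`E‖⟪x, w⟫‖²_{ℝ/ℤ} ≥ (1 − f_s(x))/(2π²)`),
  `integral_dualGaussian_inner_sq_indicator_le` (`E[⟪u, w⟫² 1_{‖w‖ ≤ R}] ≤ π/(8s²)`, `‖u‖ ≤ 1`).
* `exists_good_dualSamples` — **good witness tuples exist**: with `R = c√n/s`, if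
  `N (c√(2πe)e^{-πc²})ⁿ + N/(64 a²) + N n² R⁴/θ < 1` then some `(w₁, …, w_N) ∈ (L*)^N` has
  (i) all `‖wⱼ‖ < R`, (ii) `∑ⱼ ‖⟪x, wⱼ⟫‖²_{ℝ/ℤ} > N(1 − f_s(x))/(2π²) − a`, (iii) squared Frobenius
  deviation `< θ` of the truncated empirical moment matrix `∑ⱼ ξ(wⱼ)ξ(wⱼ)ᵀ` (coordinates
  `momentEntry` in any orthonormal basis, truncation `normTrunc`) from `N` times its mean — by the union
  bound, Chebyshev and Markov of `Probability/Moments/IIDSecondMoment.lean` (in print: Claim 6.1 and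
  Lemmas 6.2–6.3 with Chernoff–Hoeffding and an `ε`-net).
* `sum_inner_sq_le_of_good` — **the operator bound** (deterministic half of Lemma 6.2): (i) and
  (iii) give `∑ⱼ ⟪u, wⱼ⟫² ≤ (Nπ/(8s²) + √θ) ‖u‖²` for every `u` (Parseval in the basis,
  `|uᵀAu| ≤ ‖A‖_F ‖u‖²`).

The parameters `N, c, a, θ` are left free. Under this SECOND-MOMENT count BOTH integer renderings need
`N = Ω(n⁴)` samples, the third budget term being `N n² R⁴/θ = 324 n⁴ s⁴/(N · (4 s⁴ θ'))` for `c = 3`,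
`√θ = θ' N/s²`: `ARVerifier`'s completeness takes `c = 3`, `a = N/100`, `√θ = N/(2s²)` (term `324 n⁴/N`),
which its count `nSamples n = 3000 (n+1)⁴` (chosen for this reason) meets with margin `0.108`; a
`FarCert`-style operator threshold `N/(2s²)` needs `√θ ≤ N(1/2 − π/8)/s²`, i.e. `N ≳ 7040 n⁴`. (The
printed Chernoff–Hoeffding + `ε`-net argument would allow `N = O(n² log n)`; it is not formalised.)

## References

* D. Aharonov, O. Regev, *Lattice problems in NP ∩ coNP*, J. ACM 52 (2005) 749–765, §6.2
  (Claim 6.1, Lemmas 6.2, 6.3), Lemmas 2.5, 2.6, Cor. 4.2 (pp. 7–12 of the preprint).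
* D. Micciancio, O. Regev, *Worst-case to average-case reductions based on Gaussian measures*,
  SIAM J. Comput. 37 (2007), §2 (discrete Gaussian).
-/

noncomputable section

open MeasureTheory Module Literature.NumberTheory.Sieve.Vinogradov
open scoped Real InnerProductSpace ENNReal

namespace Literature.Algebra.EuclideanLattices

variable {V : Type*} [NormedAddCommGroup V] [InnerProductSpace ℝ V] [FiniteDimensional ℝ V]
  [MeasurableSpace V] [BorelSpace V]

variable (L : Submodule ℤ V) [DiscreteTopology L] [IsZLattice ℝ L]

/-- **The sampling distribution of Aharonov–Regev's witness vectors**: the discrete Gaussian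
`D_{L*, 1/s}` on the dual lattice (AR05 §4, Cor. 4.2: the Fourier series `f̂` of
`f = ρ(L − ·)/ρ(L)` "is a probability measure on the dual lattice"; here with the Gaussian parameter
`s` of the primal side made explicit, `f̂ = D_{L*, 1/s}`). Junk value: for `s ≤ 0` (`s⁻¹ ≤ 0`) this is
the point mass at `0`, as `discreteGaussian` prescribes; every theorem below assumes `0 < s`.
[cite: AharonovRegev2005, Claim 4.1 and Cor. 4.2 (p. 9)] -/
abbrev dualGaussian (s : ℝ) : PMF (dualLattice L) := discreteGaussian (dualLattice L) s⁻¹ 0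

omit [MeasurableSpace V] [BorelSpace V] in
/-- The normalising constant `Z = ρ_{1/s}(L*) > 0`. [folklore] -/
theorem tsum_dualGaussian_weight_pos {s : ℝ} (hs : 0 < s) :
    0 < ∑' w : dualLattice L, gaussianFunction s⁻¹ (w : V) := by
  have := tsum_gaussianFunction_sub_pos (dualLattice L) (inv_ne_zero hs.ne') (0 : V)
  simpa only [sub_zero] using this

omit [MeasurableSpace V] [BorelSpace V] in
/-- **The weights of `D_{L*, 1/s}`**: `D(w) = ρ_{1/s}(w) / ρ_{1/s}(L*)`. [cite: MicciancioRegev2007, §2] -/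
theorem dualGaussian_toReal {s : ℝ} (hs : 0 < s) (w : dualLattice L) :
    (dualGaussian L s w).toReal = gaussianFunction s⁻¹ (w : V) / ∑' w' : dualLattice L, gaussianFunction s⁻¹ (w' : V) := by
  rw [dualGaussian, discreteGaussian_apply _ (inv_pos.2 hs), gaussianMass_coe_eq_ofReal_tsum _ (inv_ne_zero hs.ne'),
    ENNReal.toReal_mul, ENNReal.toReal_inv, ENNReal.toReal_ofReal (gaussianFunction_pos _ _).le,
    ENNReal.toReal_ofReal (tsum_nonneg fun _ ↦ (gaussianFunction_pos _ _).le)]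
  simp only [sub_zero, div_eq_mul_inv]

/-- **Expectations under `D_{L*, 1/s}` are normalised Gaussian series**:
`E_D[g] = (∑_{w ∈ L*} ρ_{1/s}(w) g(w)) / ρ_{1/s}(L*)` for bounded `g`. [cite: MicciancioRegev2007, §2] -/
theorem integral_dualGaussian_eq {s : ℝ} (hs : 0 < s) {g : dualLattice L → ℝ} {M : ℝ} (hg : ∀ w, |g w| ≤ M) :
    ∫ w, g w ∂(dualGaussian L s).toMeasure =
      (∑' w : dualLattice L, gaussianFunction s⁻¹ (w : V) * g w) / ∑' w : dualLattice L, gaussianFunction s⁻¹ (w : V) := by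
  have hint : Integrable g (dualGaussian L s).toMeasure :=
    (memLp_of_bounded (a := -M) (b := M) (Filter.Eventually.of_forall fun x ↦ abs_le.1 (hg x))
      (measurable_of_countable g).aestronglyMeasurable 1).integrable le_rfl
  rw [PMF.integral_eq_tsum _ g hint]
  simp_rw [dualGaussian_toReal L hs, smul_eq_mul, div_mul_eq_mul_div]
  rw [tsum_div_const]

/-- The measure of a set under `D_{L*, 1/s}`, as a normalised Gaussian series over the set.
[cite: MicciancioRegev2007, §2] -/
theorem measureReal_dualGaussian_eq {s : ℝ} (hs : 0 < s) (S : Set (dualLattice L)) :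
    (dualGaussian L s).toMeasure.real S =
      (∑' w : dualLattice L, gaussianFunction s⁻¹ (w : V) * S.indicator 1 w) /
        ∑' w : dualLattice L, gaussianFunction s⁻¹ (w : V) := by
  rw [← integral_indicator_one (Set.to_countable S).measurableSet]
  exact integral_dualGaussian_eq L hs (M := 1) fun w ↦ by
    simp only [Set.indicator, Pi.one_apply]; split_ifs <;> simp

/-! ### The three expectation bounds -/

/-- **Tail of the dual samples** (Banaszczyk's Lemma 1.5 for `L*`; AR05 Lemma 2.5 as used in
Lemma 6.3: "the probability that the norm of a vector chosen from `f̂` is more than `√n` is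
`2^{-Ω(n)}`"): `Pr_{w ∼ D_{L*,1/s}}[‖w‖ ≥ c√n/s] ≤ (c√(2πe) e^{-πc²})ⁿ` for `c ≥ 1/√(2π)`.
[cite: AharonovRegev2005, Lemma 2.5 and Lemma 6.3 (pp. 7, 12)] -/
theorem measureReal_dualGaussian_tail_le {s c : ℝ} (hs : 0 < s) (hc : 1 / Real.sqrt (2 * π) ≤ c) :
    (dualGaussian L s).toMeasure.real {w | c * s⁻¹ * Real.sqrt (finrank ℝ V) ≤ ‖(w : V)‖} ≤
      (c * Real.sqrt (2 * π * Real.exp 1) * Real.exp (-π * c ^ 2)) ^ finrank ℝ V := by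
  have hZ := tsum_dualGaussian_weight_pos L hs
  rw [measureReal_dualGaussian_eq L hs, div_le_iff₀ hZ]
  have h := tsum_indicator_gaussianFunction_le (dualLattice L) (inv_pos.2 hs) hc
  refine le_trans (le_of_eq (tsum_congr fun w ↦ ?_)) h
  simp only [Set.indicator, Set.mem_setOf_eq, Pi.one_apply]
  split_ifs <;> simp

/-- **The distance-to-`ℤ` statistic has large mean at far points**:
`E_{w ∼ D_{L*,1/s}}[‖⟪x, w⟫‖²_{ℝ/ℤ}] ≥ (1 − f_s(x))/(2π²)`, `f_s(x) = ρ_s(L − x)/ρ_s(L)`.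
[cite: AharonovRegev2005, Claim 4.1 and Claim 6.1 (pp. 9–11) — variant] -/
theorem le_integral_dualGaussian_distInt_sq {s : ℝ} (hs : 0 < s) (x : V) :
    (1 - (∑' y : L, gaussianFunction s ((y : V) - x)) / ∑' y : L, gaussianFunction s (y : V)) / (2 * π ^ 2) ≤
      ∫ w, distInt ⟪x, (w : V)⟫_ℝ ^ 2 ∂(dualGaussian L s).toMeasure := by
  have hZ := tsum_dualGaussian_weight_pos L hs
  rw [integral_dualGaussian_eq L hs (M := 1 / 4) (fun w ↦ by
    rw [abs_of_nonneg (sq_nonneg _)]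
    have h := distInt_le_half ⟪x, (w : V)⟫_ℝ
    have h0 := distInt_nonneg ⟪x, (w : V)⟫_ℝ
    nlinarith)]
  rw [div_le_div_iff₀ (by positivity) hZ]
  have h := one_sub_div_mul_tsum_le_tsum_mul_distInt_sq L hs x
  linarith

/-- **Directional second moments of the truncated dual samples**:
`E_{w ∼ D_{L*,1/s}}[⟪u, w⟫² 1_{‖w‖ ≤ R}] ≤ π/(8s²)` for `‖u‖ ≤ 1`, `R > 0`.
[cite: AharonovRegev2005, Lemma 2.6 and Lemma 6.2 (pp. 8, 11) — variant] -/
theorem integral_dualGaussian_inner_sq_indicator_le {s : ℝ} (hs : 0 < s) {u : V} (hu : ‖u‖ ≤ 1) {R : ℝ} (hR : 0 < R) :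
    ∫ w, {w : dualLattice L | ‖(w : V)‖ ≤ R}.indicator (fun w ↦ ⟪u, (w : V)⟫_ℝ ^ 2) w ∂(dualGaussian L s).toMeasure ≤
      π / (8 * s ^ 2) := by
  have hZ := tsum_dualGaussian_weight_pos L hs
  rw [integral_dualGaussian_eq L hs (M := R ^ 2) (fun w ↦ by
    simp only [Set.indicator, Set.mem_setOf_eq]
    split_ifs with hw
    · rw [abs_of_nonneg (sq_nonneg _)]
      calc ⟪u, (w : V)⟫_ℝ ^ 2 ≤ (‖u‖ * ‖(w : V)‖) ^ 2 := by
            rw [← sq_abs]; exact pow_le_pow_left₀ (abs_nonneg _) (abs_real_inner_le_norm _ _) 2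
        _ ≤ (1 * R) ^ 2 := by gcongr
        _ = R ^ 2 := by ring
    · simp [sq_nonneg])]
  rw [div_le_iff₀ hZ]
  have h := tsum_gaussianFunction_mul_indicator_inner_sq_le L hs hu hR
  linarith

/-! ### Good witness tuples exist (the probabilistic method over `D_{L*,1/s}^N`) -/

section Existence

open Literature.Probability.Moments ProbabilityTheory

variable {ι : Type*} [Fintype ι]

/-- The truncation `ξ(w) = w · 1_{‖w‖ ≤ R}` of Aharonov–Regev's Lemma 6.2 (for `R < 0` it is the constant
`0`). [cite: AharonovRegev2005, Lemma 6.2 (p. 11)] -/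
def normTrunc (R : ℝ) (w : V) : V := if ‖w‖ ≤ R then w else 0

omit [InnerProductSpace ℝ V] [FiniteDimensional ℝ V] [MeasurableSpace V] [BorelSpace V] in
/-- `‖ξ(w)‖ ≤ R` for `R ≥ 0`. [folklore] -/
theorem norm_trunc_le {R : ℝ} (hR : 0 ≤ R) (w : V) : ‖normTrunc R w‖ ≤ R := by
  unfold normTrunc; split_ifs with h
  · exact h
  · simpa using hR

omit [InnerProductSpace ℝ V] [FiniteDimensional ℝ V] [MeasurableSpace V] [BorelSpace V] in
/-- `ξ(w) = w` when `‖w‖ ≤ R`. [folklore] -/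
theorem trunc_of_le {R : ℝ} {w : V} (h : ‖w‖ ≤ R) : normTrunc R w = w := by
  unfold normTrunc; rw [if_pos h]

omit [FiniteDimensional ℝ V] [MeasurableSpace V] [BorelSpace V] in
/-- `⟪u, ξ(w)⟫² = ⟪u, w⟫² 1_{‖w‖ ≤ R}`. [folklore] -/
theorem inner_trunc_sq (R : ℝ) (u w : V) :
    ⟪u, normTrunc R w⟫_ℝ ^ 2 = {w : V | ‖w‖ ≤ R}.indicator (fun w ↦ ⟪u, w⟫_ℝ ^ 2) w := by
  unfold normTrunc
  simp only [Set.indicator, Set.mem_setOf_eq]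
  split_ifs <;> simp

/-- The coordinate products `h_{ab}(w) = ⟪bₐ, ξ(w)⟫ ⟪b_b, ξ(w)⟫` of the truncated sample in an
orthonormal basis (the entries of `ξ ξᵀ`). [cite: AharonovRegev2005, Lemma 6.2 (p. 11) — variant] -/
def momentEntry (b : OrthonormalBasis ι ℝ V) (R : ℝ) (k : ι × ι) (w : V) : ℝ :=
  ⟪b k.1, normTrunc R w⟫_ℝ * ⟪b k.2, normTrunc R w⟫_ℝ

omit [FiniteDimensional ℝ V] [MeasurableSpace V] [BorelSpace V] in
/-- `|h_{ab}(w)| ≤ R²`. [folklore] -/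
theorem abs_momentEntry_le (b : OrthonormalBasis ι ℝ V) {R : ℝ} (hR : 0 ≤ R) (k : ι × ι) (w : V) :
    |momentEntry b R k w| ≤ R ^ 2 := by
  unfold momentEntry
  rw [abs_mul, sq]
  have h1 : ∀ i, |⟪b i, normTrunc R w⟫_ℝ| ≤ R := fun i ↦
    (abs_real_inner_le_norm _ _).trans (by rw [b.orthonormal.1 i, one_mul]; exact norm_trunc_le hR w)
  exact mul_le_mul (h1 _) (h1 _) (abs_nonneg _) hR

omit [FiniteDimensional ℝ V] [MeasurableSpace V] [BorelSpace V] in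
/-- **Quadratic forms in coordinates**: `∑ⱼ ⟪u, vⱼ⟫² = ∑_{a,b} uₐ u_b Sₐᵦ` with
`Sₐᵦ = ∑ⱼ (vⱼ)ₐ (vⱼ)_b` (Parseval in the orthonormal basis `b`). [folklore] -/
theorem sum_inner_sq_eq_sum_coord (b : OrthonormalBasis ι ℝ V) {N : ℕ} (u : V) (v : Fin N → V) :
    ∑ j, ⟪u, v j⟫_ℝ ^ 2 = ∑ k : ι × ι, ⟪b k.1, u⟫_ℝ * ⟪b k.2, u⟫_ℝ * ∑ j, ⟪b k.1, v j⟫_ℝ * ⟪b k.2, v j⟫_ℝ := by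
  have hP : ∀ j, ⟪u, v j⟫_ℝ = ∑ a, ⟪b a, u⟫_ℝ * ⟪b a, v j⟫_ℝ := fun j ↦ by
    rw [← b.sum_inner_mul_inner u (v j)]
    refine Finset.sum_congr rfl fun a _ ↦ by rw [real_inner_comm]
  simp_rw [hP, sq, Finset.sum_mul_sum, Fintype.sum_prod_type, Finset.mul_sum]
  rw [Finset.sum_comm]
  refine Finset.sum_congr rfl fun a _ ↦ ?_
  rw [Finset.sum_comm]
  refine Finset.sum_congr rfl fun c _ ↦ ?_
  refine Finset.sum_congr rfl fun j _ ↦ ?_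
  ring

omit [FiniteDimensional ℝ V] [MeasurableSpace V] [BorelSpace V] in
/-- **Cauchy–Schwarz for a coordinate quadratic form**: `|∑_{a,b} uₐ u_b Aₐᵦ| ≤ ‖u‖² ‖A‖_F`.
[folklore] -/
theorem abs_sum_coord_mul_le (b : OrthonormalBasis ι ℝ V) (u : V) (A : ι × ι → ℝ) :
    |∑ k : ι × ι, ⟪b k.1, u⟫_ℝ * ⟪b k.2, u⟫_ℝ * A k| ≤ ‖u‖ ^ 2 * Real.sqrt (∑ k, A k ^ 2) := by
  have hcs := Finset.sum_mul_sq_le_sq_mul_sq Finset.univ (fun k : ι × ι ↦ ⟪b k.1, u⟫_ℝ * ⟪b k.2, u⟫_ℝ) A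
  have hnorm : ∑ k : ι × ι, (⟪b k.1, u⟫_ℝ * ⟪b k.2, u⟫_ℝ) ^ 2 = (‖u‖ ^ 2) ^ 2 := by
    simp_rw [mul_pow, Fintype.sum_prod_type, ← Finset.mul_sum, ← Finset.sum_mul, b.sum_sq_inner_right]
    ring
  rw [hnorm] at hcs
  rw [← Real.sqrt_sq (abs_nonneg _), ← Real.sqrt_sq (by positivity : 0 ≤ ‖u‖ ^ 2), ← Real.sqrt_mul (sq_nonneg _)]
  refine Real.sqrt_le_sqrt ?_
  rw [sq_abs]
  exact hcs

/-- **Good witness tuples exist** (the probabilistic heart of Aharonov–Regev's completeness, §6.2,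
in second-moment form): for `N` i.i.d. samples `w₁, …, w_N ∼ D_{L*, 1/s}`, a truncation radius
`R = c√n/s` with `c ≥ 1/√(2π)`, a deviation `a > 0` for the distance-to-`ℤ` statistic and a
level `θ > 0` for the Frobenius deviation of the truncated moment matrix, if
`N (c√(2πe)e^{-πc²})ⁿ + N/(64a²) + N n² R⁴/θ < 1` then some tuple has (i) all `‖wⱼ‖ < R`,
(ii) `∑ⱼ ‖⟪x, wⱼ⟫‖²_{ℝ/ℤ} > N (1 − f_s(x))/(2π²) − a`, and (iii) Frobenius deviation
`∑_{a,b} (∑ⱼ h_{ab}(wⱼ) − N E h_{ab})² < θ`. (In print: Claim 6.1, Lemma 6.2, Lemma 6.3 with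
Chernoff–Hoeffding and an `ε`-net; for a single target point second moments suffice.)
[cite: AharonovRegev2005, §6.2 (Claim 6.1, Lemmas 6.2–6.3, pp. 11–12) — variant] -/
theorem exists_good_dualSamples {s c a θ : ℝ} (hs : 0 < s) (hc : 1 / Real.sqrt (2 * π) ≤ c) (ha : 0 < a) (hθ : 0 < θ)
    (x : V) (b : OrthonormalBasis ι ℝ V) (N : ℕ)
    (hbudget : N * (c * Real.sqrt (2 * π * Real.exp 1) * Real.exp (-π * c ^ 2)) ^ finrank ℝ V +
        N * (1 / 4) ^ 2 / (4 * a ^ 2) +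
        N * Fintype.card (ι × ι) * ((c * s⁻¹ * Real.sqrt (finrank ℝ V)) ^ 2) ^ 2 / θ < 1) :
    ∃ ω : Fin N → dualLattice L,
      (∀ j, ‖(ω j : V)‖ < c * s⁻¹ * Real.sqrt (finrank ℝ V)) ∧
      (N * ((1 - (∑' y : L, gaussianFunction s ((y : V) - x)) / ∑' y : L, gaussianFunction s (y : V)) / (2 * π ^ 2)) - a <
        ∑ j, distInt ⟪x, (ω j : V)⟫_ℝ ^ 2) ∧
      (∑ k : ι × ι, (∑ j, momentEntry b (c * s⁻¹ * Real.sqrt (finrank ℝ V)) k (ω j : V) -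
          N * ∫ w, momentEntry b (c * s⁻¹ * Real.sqrt (finrank ℝ V)) k (w : V) ∂(dualGaussian L s).toMeasure) ^ 2 < θ) := by
  set R : ℝ := c * s⁻¹ * Real.sqrt (finrank ℝ V) with hR
  have hc0 : 0 < c := lt_of_lt_of_le (by positivity) hc
  have hR0 : 0 ≤ R := by rw [hR]; positivity
  set μ := (dualGaussian L s).toMeasure with hμ
  -- the three bad events
  set B1 : Set (Fin N → dualLattice L) := {ω | ∃ j, ω j ∈ {w : dualLattice L | R ≤ ‖(w : V)‖}} with hB1
  set m : ℝ := ∫ w, distInt ⟪x, (w : V)⟫_ℝ ^ 2 ∂μ with hm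
  set B2 : Set (Fin N → dualLattice L) := {ω | ∑ j, distInt ⟪x, (ω j : V)⟫_ℝ ^ 2 ≤ N * m - a} with hB2
  set B3 : Set (Fin N → dualLattice L) := {ω | θ ≤ ∑ k : ι × ι, (∑ j, momentEntry b R k (ω j : V) -
      N * ∫ w, momentEntry b R k (w : V) ∂μ) ^ 2} with hB3
  have h1 : (IID.draws μ N).real B1 ≤ N * (c * Real.sqrt (2 * π * Real.exp 1) * Real.exp (-π * c ^ 2)) ^ finrank ℝ V := by
    refine (IID.measureReal_exists_mem_le (μ := μ) (N := N) _).trans ?_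
    exact mul_le_mul_of_nonneg_left (measureReal_dualGaussian_tail_le L hs hc) (Nat.cast_nonneg _)
  have h2 : (IID.draws μ N).real B2 ≤ N * (1 / 4) ^ 2 / (4 * a ^ 2) :=
    IID.measureReal_sum_le_sub_le (μ := μ) (N := N) (g := fun w : dualLattice L ↦ distInt ⟪x, (w : V)⟫_ℝ ^ 2)
      (fun w ↦ sq_nonneg _) (fun w ↦ by
        have h := distInt_le_half ⟪x, (w : V)⟫_ℝ
        have h0 := distInt_nonneg ⟪x, (w : V)⟫_ℝ
        nlinarith) ha
  have h3 : (IID.draws μ N).real B3 ≤ N * Fintype.card (ι × ι) * (R ^ 2) ^ 2 / θ :=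
    IID.measureReal_le_sum_sq_sub_le (μ := μ) (N := N) (h := fun k (w : dualLattice L) ↦ momentEntry b R k (w : V))
      (fun k w ↦ abs_momentEntry_le b hR0 k _) hθ
  -- union
  have hunion : (IID.draws μ N).real (B1 ∪ B2 ∪ B3) < 1 :=
    calc (IID.draws μ N).real (B1 ∪ B2 ∪ B3) ≤ (IID.draws μ N).real B1 + (IID.draws μ N).real B2 + (IID.draws μ N).real B3 :=
          (measureReal_union_le _ _).trans (add_le_add (measureReal_union_le _ _) le_rfl)
      _ ≤ _ := add_le_add (add_le_add h1 h2) h3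
      _ < 1 := hbudget
  obtain ⟨ω, hω⟩ := IID.exists_not_mem_of_measureReal_lt_one hunion
  simp only [Set.mem_union, not_or, hB1, hB2, hB3, Set.mem_setOf_eq, not_exists, not_le] at hω
  obtain ⟨⟨hω1, hω2⟩, hω3⟩ := hω
  refine ⟨ω, hω1, ?_, hω3⟩
  -- (ii): `N m − a < ∑` and `m ≥ (1 − f)/(2π²)`
  have hmean := le_integral_dualGaussian_distInt_sq L hs x
  rw [← hμ, ← hm] at hmean
  have : (N : ℝ) * ((1 - (∑' y : L, gaussianFunction s ((y : V) - x)) / ∑' y : L, gaussianFunction s (y : V)) / (2 * π ^ 2)) ≤ N * m :=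
    mul_le_mul_of_nonneg_left hmean (Nat.cast_nonneg _)
  linarith

/-- **The operator bound from a good tuple** (the deterministic half of Lemma 6.2): if all samples
have `‖wⱼ‖ ≤ R` and the truncated moment matrix deviates from its mean by `< θ` in squared Frobenius
norm, then for every `u`, `∑ⱼ ⟪u, wⱼ⟫² ≤ (N π/(8s²) + √θ) ‖u‖²` (directional second moment
`≤ π/(8s²)`, `GaussianLatticeMoments.lean`, plus Cauchy–Schwarz `|uᵀ A u| ≤ ‖A‖_F ‖u‖²`).
[cite: AharonovRegev2005, Lemma 6.2 (pp. 11–12) — variant] -/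
theorem sum_inner_sq_le_of_good {s R θ : ℝ} (hs : 0 < s) (hR : 0 < R) (b : OrthonormalBasis ι ℝ V) {N : ℕ}
    {ω : Fin N → dualLattice L} (hω1 : ∀ j, ‖(ω j : V)‖ ≤ R)
    (hω3 : ∑ k : ι × ι, (∑ j, momentEntry b R k (ω j : V) -
        N * ∫ w, momentEntry b R k (w : V) ∂(dualGaussian L s).toMeasure) ^ 2 ≤ θ) (u : V) :
    ∑ j, ⟪u, (ω j : V)⟫_ℝ ^ 2 ≤ (N * (π / (8 * s ^ 2)) + Real.sqrt θ) * ‖u‖ ^ 2 := by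
  -- reduce to `‖u‖ = 1`
  rcases eq_or_ne u 0 with rfl | hu0
  · simp
  have hun : 0 < ‖u‖ := norm_pos_iff.2 hu0
  set v : V := ‖u‖⁻¹ • u with hv
  have hv1 : ‖v‖ = 1 := by rw [hv, norm_smul, norm_inv, norm_norm, inv_mul_cancel₀ hun.ne']
  have huv : u = ‖u‖ • v := by rw [hv, smul_smul, mul_inv_cancel₀ hun.ne', one_smul]
  have hinner : ∀ w : V, ⟪u, w⟫_ℝ = ‖u‖ * ⟪v, w⟫_ℝ := fun w ↦ by
    conv_lhs => rw [huv]
    rw [real_inner_smul_left]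
  suffices hmain : ∑ j, ⟪v, (ω j : V)⟫_ℝ ^ 2 ≤ N * (π / (8 * s ^ 2)) + Real.sqrt θ by
    calc ∑ j, ⟪u, (ω j : V)⟫_ℝ ^ 2 = ‖u‖ ^ 2 * ∑ j, ⟪v, (ω j : V)⟫_ℝ ^ 2 := by
          rw [Finset.mul_sum]; refine Finset.sum_congr rfl fun j _ ↦ ?_
          rw [hinner]; ring
      _ ≤ ‖u‖ ^ 2 * (N * (π / (8 * s ^ 2)) + Real.sqrt θ) := mul_le_mul_of_nonneg_left hmain (sq_nonneg _)
      _ = _ := by ring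
  -- coordinates: `S_k = ∑ⱼ h_k(ωⱼ)` (truncation inactive), `M_k = ∫ h_k`
  set μ := (dualGaussian L s).toMeasure with hμ
  set Sk : ι × ι → ℝ := fun k ↦ ∑ j, momentEntry b R k (ω j : V) with hSk
  set Mk : ι × ι → ℝ := fun k ↦ ∫ w, momentEntry b R k (w : V) ∂μ with hMk
  have hS : ∑ j, ⟪v, (ω j : V)⟫_ℝ ^ 2 = ∑ k : ι × ι, ⟪b k.1, v⟫_ℝ * ⟪b k.2, v⟫_ℝ * Sk k := by
    rw [sum_inner_sq_eq_sum_coord b v (fun j ↦ (ω j : V))]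
    refine Finset.sum_congr rfl fun k _ ↦ ?_
    simp only [hSk, momentEntry, trunc_of_le (hω1 _)]
  -- the mean quadratic form is the truncated directional second moment
  have hM : ∑ k : ι × ι, ⟪b k.1, v⟫_ℝ * ⟪b k.2, v⟫_ℝ * Mk k =
      ∫ w, {w : dualLattice L | ‖(w : V)‖ ≤ R}.indicator (fun w ↦ ⟪v, (w : V)⟫_ℝ ^ 2) w ∂μ := by
    have hint : ∀ k, Integrable (fun w : dualLattice L ↦ momentEntry b R k (w : V)) μ := fun k ↦
      (memLp_of_bounded (a := -R ^ 2) (b := R ^ 2)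
        (Filter.Eventually.of_forall fun w ↦ abs_le.1 (abs_momentEntry_le b hR.le k _))
        (measurable_of_countable _).aestronglyMeasurable 1).integrable le_rfl
    simp_rw [hMk, ← integral_const_mul]
    rw [← integral_finsetSum _ fun k _ ↦ (hint k).const_mul _]
    refine integral_congr_ae (Filter.Eventually.of_forall fun w ↦ ?_)
    have h1 := sum_inner_sq_eq_sum_coord b v (fun _ : Fin 1 ↦ normTrunc R (w : V))
    simp only [Finset.univ_unique, Fin.default_eq_zero, Finset.sum_singleton] at h1
    rw [inner_trunc_sq] at h1
    simp only [momentEntry]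
    rw [← h1]
    simp only [Set.indicator, Set.mem_setOf_eq]
  have hMle : ∑ k : ι × ι, ⟪b k.1, v⟫_ℝ * ⟪b k.2, v⟫_ℝ * Mk k ≤ π / (8 * s ^ 2) := by
    rw [hM]
    exact integral_dualGaussian_inner_sq_indicator_le L hs hv1.le hR
  -- deviation
  have hdev : ∑ k : ι × ι, ⟪b k.1, v⟫_ℝ * ⟪b k.2, v⟫_ℝ * (Sk k - N * Mk k) ≤ Real.sqrt θ := by
    refine (le_abs_self _).trans ((abs_sum_coord_mul_le b v _).trans ?_)
    rw [hv1, one_pow, one_mul]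
    exact Real.sqrt_le_sqrt hω3
  have hsplit : ∑ k : ι × ι, ⟪b k.1, v⟫_ℝ * ⟪b k.2, v⟫_ℝ * Sk k =
      N * ∑ k : ι × ι, ⟪b k.1, v⟫_ℝ * ⟪b k.2, v⟫_ℝ * Mk k +
        ∑ k : ι × ι, ⟪b k.1, v⟫_ℝ * ⟪b k.2, v⟫_ℝ * (Sk k - N * Mk k) := by
    rw [Finset.mul_sum, ← Finset.sum_add_distrib]
    refine Finset.sum_congr rfl fun k _ ↦ by ring
  rw [hS, hsplit]
  nlinarith [hMle, hdev, Nat.cast_nonneg (α := ℝ) N]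

end Existence

end Literature.Algebra.EuclideanLattices

end
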